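import Summits.Langlands.Langlands.Theses.ExteriorSquareAscent
import Literature.NumberTheory.Automorphic.ExteriorSquareNoHeckeEigenvalueGL4
import Literature.NumberTheory.Automorphic.CuspidalContragredientProofs

/-!
# Stub `stub_noLineAnalytic` of line `Sketch` for crux stmt-Langlands-18054
(`Summit.Langlands.Langlands.Theses.ExteriorSquareAscent.ReducibleInducesSquare`)

The `(3,1)` case of a reducible compatible `ρ` is EMPTY (Shavali 2026, arXiv:2603.19768, Prop. 4.1,
transplanted to an arbitrary number field and stripped of every weight hypothesis): for `π` cuspidal on
`GL₄(𝔸_K)`, `Π` a CUSPIDAL datum on `GL₆(𝔸_K)` with `t_Π = ∧² t_π` a.e. (supplied by the neighbouring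
stub `stub_wedgeTwoCuspidal`; here a hypothesis) and a Hecke character `μ`, it is NOT the case that
`μ(ϖ_v) ∈ t_{π,v}` a.e. — granting Jacquet–Shalika (2.2) for Borel–Jacquet data (the fact-stub
`stub_factJS22`, here the hypothesis `JacquetShalika1981_partialPairL_boundary_repData`).

All the work is in the library file
`Literature/NumberTheory/Automorphic/ExteriorSquareNoHeckeEigenvalueGL4` (landed with this stub; the
`n = 4` twin of `BockleHuiIrreducibleGL3{Analytic,Weight,NoContragredient}Proofs`): the eight-term
Euler-factor identity `L(Π × μ⁻²) L(ω μ⁻⁴) ζ_K^S = L(π^∨ × ω μ⁻³) L(π × μ⁻¹)`, its pole count on the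
unitary axis (pole of order `≥ 1` on the left — Hecke, (2.2) for `GL₆ × GL₁` and the THEOREM (2.2) for
`GL₁ × GL₁` — finite right side) and off it (absolute convergence after shifting), assembled in
`false_of_heckeEigenvalue_mem_satake_gl4` for unitary data of slope `t ≥ 0`.  This file only
unitarises: `Ω` = central character at Satake level (`centralCharacter_satake_of_cuspidal`),
`|Ω| = ‖·‖^{σ}`, `λ = ‖·‖^{-σ/4}` (`exists_heckeCharacter_ideleNorm_cpow`), `π₀ = π ⊗ λ`, `Π₀ = Π ⊗ λ²`
(`exists_twist_hecke_hasSatakeParamAt`, `wedgeTwoParams_map_mul`), `π₀^∨`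
(`exists_contragredient_satake_holds`, PROVED), `θ = λ μ`, `ω = λ⁴ Ω`; and if the slope of `θ` has the
wrong sign it passes to the dual data `(π₀^∨, π₀, Π₀ ⊗ ω⁻¹, ω⁻¹, θ⁻¹)`
(`∧²(β⁻¹) = ω⁻¹ ∧² β`, `wedgeTwoParams_map_inv_eq_map_prod_inv_mul`).
-/

set_option linter.dupNamespace false -- `Summit.Langlands.Langlands` is the mandated namespace

noncomputable section

namespace Summit.Langlands.Langlands.Cruxes.ReducibleInducesSquare.Sketch

open Literature.NumberTheory
open Literature.NumberTheory.GaloisRepresentations (HeckeCharacter ideleGroup)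
open Literature.NumberTheory.Automorphic
open NumberField IsDedekindDomain Filter Polynomial
open scoped Classical MatrixGroups NumberField Topology

/-! ### The stub -/

/-- **STUB F — no Hecke character among the Satake eigenvalues of a cuspidal `π` on `GL₄` with
cuspidal exterior square (the `(3,1)` case is empty; any `K`, no weight hypothesis).**  Granting
Jacquet–Shalika (2.2) for Borel–Jacquet data: for `π` cuspidal on `GL₄(𝔸_K)`, `Π` cuspidal on
`GL₆(𝔸_K)` with `t_Π = ∧² t_π` a.e., and a Hecke character `μ`, it is NOT the case that
`μ(ϖ_v) ∈ t_{π,v}` a.e.  Proof: with `Ω` the central character at Satake level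
(`centralCharacter_satake_of_cuspidal`), `|Ω| = ‖·‖^{σ}` and `λ = ‖·‖^{-σ/4}`
(`exists_heckeCharacter_ideleNorm_cpow`), the twists `π₀ = π ⊗ λ`, `Π₀ = Π ⊗ λ²`
(`exists_twist_hecke_hasSatakeParamAt`; `∧²(λ t) = λ² ∧² t`, `wedgeTwoParams_map_mul`), the
contragredient datum `π₀^∨` (`exists_contragredient_satake_holds`), `ω = λ⁴ Ω` and `θ = λ μ` are the
data of `false_of_heckeEigenvalue_mem_satake_gl4` (unitary family `β = λ(ϖ) t_π`); if the slope
of `θ` has the wrong sign, pass to the dual data `(π₀^∨, π₀, Π₀ ⊗ ω⁻¹, β⁻¹, ω⁻¹, θ⁻¹)`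
(`∧²(β⁻¹) = ω⁻¹ ∧² β`, `wedgeTwoParams_map_inv_eq_map_prod_inv_mul`).
[cite: BockleHui2025, §3.2.1] [cite: ArthurClozelAMS120, Ch. 3 §2 (2.1)–(2.3)] -/
theorem stub_noLineAnalytic :
    ∀ (K : Type) [Field K] [NumberField K]
      (hcpt : Literature.NumberTheory.Automorphic.isCompact_glFiniteIntegralLevel 4 K)
      (h6 : Literature.NumberTheory.Automorphic.isCompact_glFiniteIntegralLevel 6 K)
      (π : Literature.NumberTheory.Automorphic.CuspidalAutomorphicRepData 4 K hcpt)
      (P6 : Literature.NumberTheory.Automorphic.CuspidalAutomorphicRepData 6 K h6),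
      Literature.NumberTheory.Automorphic.JacquetShalika1981_partialPairL_boundary_repData →
      (∀ᶠ v : IsDedekindDomain.HeightOneSpectrum (NumberField.RingOfIntegers K) in Filter.cofinite,
        ∀ α : Multiset ℂ, π.1.HasSatakeParamAt v α →
          P6.1.HasSatakeParamAt v (Literature.NumberTheory.Automorphic.wedgeTwoParams α)) →
      ∀ μ : Literature.NumberTheory.GaloisRepresentations.HeckeCharacter K,
        ¬ (∀ᶠ v : IsDedekindDomain.HeightOneSpectrum (NumberField.RingOfIntegers K) in Filter.cofinite,
            ∀ α : Multiset ℂ, π.1.HasSatakeParamAt v α → μ.valueAtUniformizer v ∈ α) := by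
  intro K _ _ hcpt h6 π P6 hJ2 hP6 μ hμ
  haveI : NeZero (4 : ℕ) := ⟨by norm_num⟩
  haveI : NeZero (6 : ℕ) := ⟨by norm_num⟩
  -- the central character at Satake level and the unitarisation `λ = ‖·‖^{-σ/4}`
  obtain ⟨Ω, hΩ⟩ := centralCharacter_satake_of_cuspidal π
  obtain ⟨σ, hσ⟩ := Ω.exists_norm_apply_eq_ideleNorm_rpow
  obtain ⟨lam, hlam⟩ := exists_heckeCharacter_ideleNorm_cpow K (((-(σ / 4)) : ℝ) : ℂ)
  have hnlam : ∀ x : ideleGroup K,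
      ‖((lam x : ℂˣ) : ℂ)‖ = GaloisRepresentations.ideleNorm x ^ (-(σ / 4)) := fun x => by
    rw [hlam x, Complex.norm_cpow_eq_rpow_re_of_pos (HeckeCharacter.ideleNorm_pos' _ x),
      Complex.ofReal_re]
  have hnlamw : ∀ w, ‖lam.valueAtUniformizer w‖ = (w.residueCard : ℝ) ^ (σ / 4) := fun w => by
    rw [norm_valueAtUniformizer_eq_rpow_neg_of_norm_apply hnlam, neg_neg]
  have hnΩ : ∀ w, ‖Ω.valueAtUniformizer w‖ = (w.residueCard : ℝ) ^ (-σ) :=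
    norm_valueAtUniformizer_eq_rpow_neg_of_norm_apply hσ
  -- the data `π₀ = π ⊗ λ`, `Π₀ = Π ⊗ λ²`, `π₀^∨`, `θ = λ μ`, `ω = λ⁴ Ω`
  obtain ⟨P, hP⟩ := CuspidalAutomorphicRepData.exists_twist_hecke_hasSatakeParamAt lam π
  obtain ⟨Q, hQ⟩ := CuspidalAutomorphicRepData.exists_twist_hecke_hasSatakeParamAt (lam ^ 2) P6
  obtain ⟨Pd, hPd⟩ := CuspidalAutomorphicRepData.exists_contragredient_satake_holds hcpt P
  obtain ⟨απ, eπ⟩ := exists_satakeFamily_eventually_hasSatakeParamAt π.1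
  set β : SatakeFamily K := fun w => (απ w).map (lam.valueAtUniformizer w * ·) with hβdef
  set θ : HeckeCharacter K := lam * μ with hθdef
  set ω : HeckeCharacter K := lam ^ 4 * Ω with hωdef
  have hPβ : ∀ᶠ w : HeightOneSpectrum (𝓞 K) in cofinite, P.1.HasSatakeParamAt w (β w) := by
    filter_upwards [eπ, hP] with w hw hPw
    exact hPw _ hw
  have hPdβ : ∀ᶠ w : HeightOneSpectrum (𝓞 K) in cofinite,
      Pd.1.HasSatakeParamAt w ((β w).map (·⁻¹)) :=
    hPβ.mono fun w hw => hPd w _ hw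
  have hQβ : ∀ᶠ w : HeightOneSpectrum (𝓞 K) in cofinite,
      Q.1.HasSatakeParamAt w (wedgeTwoParams (β w)) := by
    filter_upwards [eπ, hP6, hQ] with w hw h6w hQw
    have h := hQw _ (h6w _ hw)
    rwa [HeckeCharacter.valueAtUniformizer_pow, ← wedgeTwoParams_map_mul] at h
  have hωβ : ∀ᶠ w : HeightOneSpectrum (𝓞 K) in cofinite, ω.valueAtUniformizer w = (β w).prod := by
    filter_upwards [eπ, hΩ] with w hw hΩw
    show _ = ((απ w).map (lam.valueAtUniformizer w * ·)).prod
    rw [prod_map_const_mul_eq, hw.card_eq, ← hΩw _ hw, hωdef, HeckeCharacter.valueAtUniformizer_mul,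
      HeckeCharacter.valueAtUniformizer_pow]
  have huβ : ∀ᶠ w : HeightOneSpectrum (𝓞 K) in cofinite, ‖(β w).prod‖ = 1 := by
    filter_upwards [eπ, hΩ] with w hw hΩw
    have hq : (0 : ℝ) < w.residueCard := by exact_mod_cast lt_trans zero_lt_one w.one_lt_residueCard
    show ‖((απ w).map (lam.valueAtUniformizer w * ·)).prod‖ = 1
    rw [prod_map_const_mul_eq, hw.card_eq, ← hΩw _ hw, norm_mul, norm_pow, hnlamw, hnΩ,
      ← Real.rpow_natCast, ← Real.rpow_mul hq.le, ← Real.rpow_add hq,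
      show σ / 4 * ((4 : ℕ) : ℝ) + -σ = 0 by push_cast; ring, Real.rpow_zero]
  have hθβ : ∀ᶠ w : HeightOneSpectrum (𝓞 K) in cofinite, θ.valueAtUniformizer w ∈ β w := by
    filter_upwards [eπ, hμ] with w hw hμw
    show θ.valueAtUniformizer w ∈ (απ w).map (lam.valueAtUniformizer w * ·)
    rw [hθdef, HeckeCharacter.valueAtUniformizer_mul]
    exact Multiset.mem_map_of_mem _ (hμw _ hw)
  -- the slope of `θ`: `|θ| = ‖·‖^{s₀}`
  obtain ⟨s₀, hs₀⟩ := θ.exists_norm_apply_eq_ideleNorm_rpow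
  rcases le_or_gt s₀ 0 with hle | hgt
  · exact false_of_heckeEigenvalue_mem_satake_gl4 hJ2 P Pd Q β hPβ hPdβ hQβ huβ ω hωβ θ hθβ
      (t := -s₀) (by linarith) (fun x => by rw [hs₀ x, neg_neg])
  · -- the dual data `(π₀^∨, π₀, Π₀ ⊗ ω⁻¹, β⁻¹, ω⁻¹, θ⁻¹)`
    obtain ⟨Qd, hQd⟩ := CuspidalAutomorphicRepData.exists_twist_hecke_hasSatakeParamAt ω⁻¹ Q
    have hQdβ : ∀ᶠ w : HeightOneSpectrum (𝓞 K) in cofinite,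
        Qd.1.HasSatakeParamAt w (wedgeTwoParams ((β w).map (·⁻¹))) := by
      filter_upwards [hPβ, hQβ, hQd, hωβ] with w h₀ h₁ h₂ h₃
      rw [wedgeTwoParams_map_inv_eq_map_prod_inv_mul h₀.card_eq
          (fun h0 => hasSatakeParamAt_ne_zero_holds h₀ 0 h0 rfl), ← h₃,
        ← HeckeCharacter.valueAtUniformizer_inv]
      exact h₂ _ h₁
    refine false_of_heckeEigenvalue_mem_satake_gl4 hJ2 Pd P Qd (fun w => (β w).map (·⁻¹)) hPdβ
      (hPβ.mono fun w hw => by rwa [satakeParam_inv_inv]) hQdβ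
      (huβ.mono fun w hw => by rw [Multiset.prod_map_inv, Multiset.map_id', norm_inv, hw, inv_one])
      ω⁻¹ (hωβ.mono fun w hw => by
        rw [HeckeCharacter.valueAtUniformizer_inv, hw, Multiset.prod_map_inv, Multiset.map_id'])
      θ⁻¹ (hθβ.mono fun w hw => by
        rw [HeckeCharacter.valueAtUniformizer_inv]; exact Multiset.mem_map_of_mem _ hw)
      (t := s₀) hgt.le (fun x => ?_)
    rw [GaloisRepresentations.HeckeCharacter.inv_apply, Units.val_inv_eq_inv_val, norm_inv, hs₀ x,
      Real.rpow_neg (HeckeCharacter.ideleNorm_pos' _ x).le]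

end Summit.Langlands.Langlands.Cruxes.ReducibleInducesSquare.Sketch
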